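import Summits.Ventures.HSemireg.WedgeHankelFaces

/-!
# Venture HSemireg — THEOREM H's CEILING and the PURE POWERS of `Θ`: `rank(θ ↦ θ ∧ w_m(q) ∣ ⋀^k) ≤ C(m,k)·min(k+1, m+1−k)` for EVERY class,
# the SPIKE LAW `rank H_k(Θ^p/p!) = min(k+1, m+1−k, p+1, m+1−p)`, and the middle power `Θ^{⌊m/2⌋}` ATTAINS the ceiling in every degree

HONEST FRAMING. Part of the Lean index of the computation cell `pub-hsemireg` (seat p10 gen 10, Sunday typer «UNIFORM-IN-n»).
Ranks of HANKEL MATRICES over a field and th-7's THEOREM H ONLY: no variety, no cohomology theory, no sheaf, no Ext group and no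
semiregularity map is constructed here; nothing here says that HC / HC_CM / HC_AV holds; no Literature fact is declared or used.
Custodian versions cited: theory/FORMULA-N.md PART A §2.6 THEOREM H and its KRONECKER DICTIONARY («ρ = 1 pure; ρ = 2 …; ρ = 3 generic ℂ[Θ]
(3C(n,2) on HT², n ≥ 4)»; «v-independent kernel the Θ-isotropic part»), §7 FN-4; PART B §N.8 (th-7); STRUCTURE.md v1.0-SIGNED 9b196a05977dd067
§1.1 C15.  The dictionary (a class `v = Σ_j q_j Θ^j/j! ∈ K[Θ]` on an abelian `m`-fold ↦ th-7's Hankel class `w_m(q) = Σ_j q_j E_j`, so the PURE POWER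
`Θ^p/p!` ↦ the SPIKE sequence `δ_p` ↦ `E_p`; `⌟v` on `HT^k` ↦ `θ ↦ θ ∧ w_m(q)` on `⋀^k K^{2m}`, sign-blind) is QUOTED, never asserted.

WHAT IS IN THE TREE.  THEOREM H (`WedgeHankelModel.hankelLaw_model`: `dim range(θ ↦ θ ∧ w_m(q) ∣ ⋀^k) = C(m,k)·rank H_k(q)`, `H_k(q) =
(q_{i+s})_{i ≤ k, s ≤ m−k}`) and the Hankel-rank-2 / rank-1 faces (point pair, transverse pair; p10 g10's `WedgeHankelFaces`: tangent, one
exponential).  NOT in the tree: the CEILING of THEOREM H valid for every class, the generic face «ρ = 3: 3C(n,2) on HT²» as a theorem, and the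
ranks of the pure powers `Θ^p`.  THIS FILE (PLAIN: imports the built tree files `WedgeHankelGlue`, `WedgePairRank` only):
* §1 **THE CEILING** (matrix sizes only): `rank H_k(q) ≤ min(k+1, m+1−k)` for EVERY `q` (`rank_hankel1_le`), hence by THEOREM H
  **`finrank_range_wedge_w_le`: `rank(θ ↦ θ ∧ w_m(q) ∣ ⋀^k K^{2m}) ≤ C(m,k)·min(k+1, m+1−k)` for EVERY field, `m`, `k`, `q`** — no `K[Θ]`-class
  contracts better than that; kernel floor `dim ker ≥ C(2m,k) − C(m,k)·min(k+1, m+1−k)` (`finrank_ker_wedge_w_ge`); in degree `2`, `m ≥ 4`: rank `≤ 3C(m,2)`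
  (th-6's «3C(n,2) on HT²», `ceiling_two`), kernel `≥ C(2m,2) − 3C(m,2) = m(m+1)/2 > 0` — on `HT²` EVERY polynomial-in-`Θ` class has a kernel
  (`two_mul_kerFloor_two`).
* §2 **THE SPIKE LAW** (the pure power `Θ^p/p!`, sequence `δ_p`): `H_k(δ_p)` is the `0/1` matrix supported on the anti-diagonal `i + s = p`, so
  **`rank_hankel1_spikeSeq`: `rank H_k(δ_p) = min(k,p) + 1 − (p − (m−k))`** (`k ≤ m`; truncated subtraction) **= min(k+1, m+1−k, p+1, m+1−p)** for
  `p ≤ m` (`rank_hankel1_spikeSeq_eq_min`; `0` for `p > m`), hence **`finrank_range_wedge_w_spikeSeq`: `rank(θ ↦ θ ∧ E_p ∣ ⋀^k) = C(m,k)·min(k+1,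
  m+1−k, p+1, m+1−p)`** (`k, p ≤ m`) — `p = 0` is the pure class `1` (`(1+t)^m`), `p = 1` the bare `Θ` (`P_m`, = `WedgeHankelFaces`' tangent face at
  `A = 0`), and the rank GROWS with `min(p, m−p)`.
* §3 **THE CEILING IS SHARP: the middle power `Θ^{⌊m/2⌋}` is Hankel-generic** — `rank H_k(δ_{⌊m/2⌋}) = min(k+1, m+1−k)` for every `k ≤ m`
  (`rank_hankel1_spike_middle`) and **`finrank_range_wedge_w_spike_middle`: `rank(θ ↦ θ ∧ E_{⌊m/2⌋} ∣ ⋀^k) = C(m,k)·min(k+1, m+1−k)` for EVERY `k`**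
  (`0 = 0` above `m`): the ceiling of §1 is attained in every degree at once by ONE pure power (C15's «generic» face realised by `Θ^{⌊m/2⌋}/⌊m/2⌋!`).
* §4 the same in th-6's typing (`FormulaN.wedgeWith`, transport along th-7's `Φ`): `ceilingLawAt`, `purePowerLawAt`, `middlePowerLawAt`.
NOT typed: which NON-monomial classes attain the ceiling (generic `q`, a Zariski-open statement); the kernel NAME («Θ-isotropic part»); per-q /
box refinements (the box ceiling `Π_i G_{m_i}` follows from p10 g10's `WedgeHankelBox` by value); anything Ext-side.  Class side only.
Namespace `Summit.Ventures.HSemireg.Wedge.HankelSpikes` (new); new names only.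
-/

open Module

namespace Summit.Ventures.HSemireg.Wedge.HankelSpikes

open Summit.Ventures.HSemireg.Wedge

variable (K : Type*) [Field K] (m : ℕ)

/-! ## §1. The ceiling of THEOREM H -/

/-- **`rank H_k(q) ≤ min(k+1, m+1−k)`** for every sequence `q` (the Hankel matrix has `k+1` rows and `m+1−k` columns). -/
theorem rank_hankel1_le (k : ℕ) (q : ℕ → K) : (Hankel.hankel1 K m k q).rank ≤ min (k + 1) (m + 1 - k) :=
  le_min (Matrix.rank_le_height _) (Matrix.rank_le_width _)

/-- **THE CEILING: `rank(θ ↦ θ ∧ w_m(q) ∣ ⋀^k K^{2m}) ≤ C(m,k)·min(k+1, m+1−k)`** for EVERY field, `m`, `k` and class `q` (THEOREM H + sizes). -/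
theorem finrank_range_wedge_w_le (k : ℕ) (q : ℕ → K) :
    finrank K (LinearMap.range (Hankel.wedge K m k (Hankel.w K m m q))) ≤ m.choose k * min (k + 1) (m + 1 - k) := by
  rw [Hankel.hankelLaw_model]
  exact Nat.mul_le_mul_left _ (rank_hankel1_le K m k q)

/-- `dim ⋀^k K^{2m} = C(2m, k)`. -/
lemma finrank_exteriorPower_In (k : ℕ) : finrank K (⋀[K]^k (Hankel.In m → K)) = (m + m).choose k := by
  rw [exteriorPower.finrank_eq, finrank_fintype_fun_eq_card, Fintype.card_fin]

/-- **KERNEL FLOOR: `dim ker(θ ↦ θ ∧ w_m(q) ∣ ⋀^k) ≥ C(2m,k) − C(m,k)·min(k+1, m+1−k)`** for every class `q` (rank–nullity and the ceiling). -/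
theorem finrank_ker_wedge_w_ge (k : ℕ) (q : ℕ → K) :
    (m + m).choose k - m.choose k * min (k + 1) (m + 1 - k) ≤
      finrank K (LinearMap.ker (Hankel.wedge K m k (Hankel.w K m m q))) := by
  have h := LinearMap.finrank_range_add_finrank_ker (Hankel.wedge K m k (Hankel.w K m m q))
  rw [finrank_exteriorPower_In] at h
  have h2 := finrank_range_wedge_w_le K m k q
  omega

/-- in degree `2` and dimension `m ≥ 4` the ceiling reads `3·C(m,2)` (th-6's «ρ = 3 generic: 3C(n,2) on HT², n ≥ 4»). -/
theorem ceiling_two (hm : 4 ≤ m) : m.choose 2 * min (2 + 1) (m + 1 - 2) = 3 * m.choose 2 := by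
  rw [min_eq_left (by omega), mul_comm]

/-- binomial bookkeeping: `2·C(2m,2) = 6·C(m,2) + m(m+1)` (i.e. `C(2m,2) − 3C(m,2) = m(m+1)/2`). -/
theorem two_mul_choose_two_add : 2 * (m + m).choose 2 = 2 * (3 * m.choose 2) + m * (m + 1) := by
  have h : ((2 * (m + m).choose 2 : ℕ) : ℚ) = ((2 * (3 * m.choose 2) + m * (m + 1) : ℕ) : ℚ) := by
    push_cast [Nat.cast_choose_two]
    ring
  exact_mod_cast h

/-- the degree-`2` kernel floor is `C(2m,2) − 3C(m,2) = m(m+1)/2`, written without division: `2·(C(2m,2) − 3C(m,2)) = m(m+1)` — so on `HT²`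
EVERY polynomial-in-`Θ` class has a kernel of dimension at least `m(m+1)/2 > 0` for `m ≥ 1` (th-6: «v-independent kernel the Θ-isotropic part»). -/
theorem two_mul_kerFloor_two : 2 * ((m + m).choose 2 - 3 * m.choose 2) = m * (m + 1) := by
  have h := two_mul_choose_two_add m
  generalize m * (m + 1) = N at h ⊢
  omega

/-! ## §2. The spike law: the pure powers `Θ^p/p!` -/

/-- the SPIKE sequence `δ_p = (0, …, 0, 1, 0, …)` (the class `Θ^p/p!`; `w_m(δ_p) = E_p`). -/
def spikeSeq (p : ℕ) : ℕ → K := fun j => if j = p then 1 else 0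

/-- values of the spike sequence. -/
@[simp] lemma spikeSeq_apply (p j : ℕ) : spikeSeq K p j = if j = p then 1 else 0 := rfl

variable {m}

/-- **THE SPIKE LAW: `rank H_k(δ_p) = min(k,p) + 1 − (p − (m−k))`** for `k ≤ m` (truncated subtraction; the `0/1` anti-diagonal matrix
`[i + s = p]` has exactly that many ones, in distinct rows and columns). -/
theorem rank_hankel1_spikeSeq {k : ℕ} (hk : k ≤ m) (p : ℕ) :
    (Hankel.hankel1 K m k (spikeSeq K p)).rank = min k p + 1 - (p - (m - k)) := by
  classical
  set M := Hankel.hankel1 K m k (spikeSeq K p) with hM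
  -- the row indices hit by the anti-diagonal
  set S : Finset (Fin (k + 1)) := Finset.univ.filter fun i => (i : ℕ) ≤ p ∧ p - (i : ℕ) ≤ m - k with hS
  have hmemS : ∀ i : Fin (k + 1), i ∈ S ↔ (i : ℕ) ≤ p ∧ p - (i : ℕ) ≤ m - k := fun i => by
    rw [hS, Finset.mem_filter]
    simp only [Finset.mem_univ, true_and]
  -- its cardinality
  have hcardS : S.card = min k p + 1 - (p - (m - k)) := by
    have hmap : S.map Fin.valEmbedding = Finset.Icc (p - (m - k)) (min k p) := by
      ext x
      rw [Finset.mem_map, Finset.mem_Icc]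
      constructor
      · rintro ⟨i, hi, rfl⟩
        rw [hmemS] at hi
        have := i.2
        rw [Fin.valEmbedding_apply]
        exact ⟨by omega, le_min (by omega) hi.1⟩
      · rintro ⟨h1, h2⟩
        have hxk : x ≤ k := le_trans h2 (min_le_left _ _)
        have hxp : x ≤ p := le_trans h2 (min_le_right _ _)
        refine ⟨⟨x, by omega⟩, ?_, rfl⟩
        rw [hmemS]
        refine ⟨hxp, ?_⟩
        show p - x ≤ m - k
        omega
    rw [← Finset.card_map Fin.valEmbedding, hmap, Nat.card_Icc]
  -- the standard basis vectors indexed by S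
  set u : S → (Fin (k + 1) → K) := fun x => Pi.basisFun K (Fin (k + 1)) x with hu
  have hli : LinearIndependent K u :=
    (Pi.basisFun K (Fin (k + 1))).linearIndependent.comp ((↑) : S → Fin (k + 1)) Subtype.val_injective
  have hcard : finrank K (Submodule.span K (Set.range u)) = S.card := by
    rw [finrank_span_eq_card hli, Fintype.card_coe]
  -- the columns: column `s` is `e_{p−s}` when `s ≤ p` and `p − s ≤ k`, else `0`
  have hentry : ∀ (i : Fin (k + 1)) (s : Fin (m + 1 - k)), M i s = if (i : ℕ) + (s : ℕ) = p then 1 else 0 := by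
    intro i s
    rw [hM, Hankel.hankel1, Matrix.of_apply, spikeSeq_apply]
  have hcol_of : ∀ s : Fin (m + 1 - k), ∀ hs : (s : ℕ) ≤ p ∧ p - (s : ℕ) ≤ k,
      M.col s = Pi.single (⟨p - (s : ℕ), by omega⟩ : Fin (k + 1)) 1 := by
    intro s hs
    funext i
    rw [Matrix.col_apply, hentry, Pi.single_apply]
    have : ((i : ℕ) + (s : ℕ) = p) ↔ i = ⟨p - (s : ℕ), by omega⟩ := by
      rw [Fin.ext_iff]
      simp only
      omega
    simp only [this]
  have hcol_zero : ∀ s : Fin (m + 1 - k), ¬ ((s : ℕ) ≤ p ∧ p - (s : ℕ) ≤ k) → M.col s = 0 := by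
    intro s hs
    funext i
    rw [Matrix.col_apply, hentry, Pi.zero_apply, if_neg]
    intro h
    have := i.2
    exact hs ⟨by omega, by omega⟩
  have hspan : Submodule.span K (Set.range M.col) = Submodule.span K (Set.range u) := by
    apply le_antisymm
    · apply Submodule.span_le.mpr
      rintro _ ⟨s, rfl⟩
      by_cases hs : (s : ℕ) ≤ p ∧ p - (s : ℕ) ≤ k
      · have hiS : (⟨p - (s : ℕ), by omega⟩ : Fin (k + 1)) ∈ S := by
          rw [hmemS]
          have := s.2
          exact ⟨by simp only; omega, by simp only; omega⟩
        rw [hcol_of s hs]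
        have : Pi.single (⟨p - (s : ℕ), by omega⟩ : Fin (k + 1)) (1 : K) = u ⟨_, hiS⟩ := by
          rw [hu]
          simp only [Pi.basisFun_apply]
        rw [this]
        exact Submodule.subset_span ⟨_, rfl⟩
      · rw [hcol_zero s hs]
        exact Submodule.zero_mem _
    · apply Submodule.span_le.mpr
      rintro _ ⟨⟨i, hi⟩, rfl⟩
      rw [hmemS] at hi
      have hik := i.2
      let s : Fin (m + 1 - k) := ⟨p - (i : ℕ), by omega⟩
      have hs : (s : ℕ) ≤ p ∧ p - (s : ℕ) ≤ k := ⟨by simp only [s]; omega, by simp only [s]; omega⟩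
      have hcol := hcol_of s hs
      have hidx : (⟨p - (s : ℕ), by omega⟩ : Fin (k + 1)) = i := by
        apply Fin.ext
        simp only [s]
        omega
      rw [hidx] at hcol
      have : u ⟨i, by rw [hmemS]; exact hi⟩ = M.col s := by
        rw [hu, hcol]
        simp only [Pi.basisFun_apply]
      rw [this]
      exact Submodule.subset_span ⟨s, rfl⟩
  rw [Matrix.rank_eq_finrank_span_cols, hspan, hcard, hcardS]

/-- the spike law in symmetric form: **`rank H_k(δ_p) = min(k+1, m+1−k, p+1, m+1−p)`** for `k, p ≤ m`. -/
theorem rank_hankel1_spikeSeq_eq_min {k : ℕ} (hk : k ≤ m) {p : ℕ} (hp : p ≤ m) :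
    (Hankel.hankel1 K m k (spikeSeq K p)).rank = min (min (k + 1) (m + 1 - k)) (min (p + 1) (m + 1 - p)) := by
  rw [rank_hankel1_spikeSeq K hk p]
  omega

/-- above the top degree a spike sees nothing: `rank H_k(δ_p) = 0` for `p > m` (and `k ≤ m`). -/
theorem rank_hankel1_spikeSeq_eq_zero {k : ℕ} (hk : k ≤ m) {p : ℕ} (hp : m < p) :
    (Hankel.hankel1 K m k (spikeSeq K p)).rank = 0 := by
  rw [rank_hankel1_spikeSeq K hk p]
  omega

variable (m)

/-- **THE PURE POWER `Θ^p/p!` IN THE WEDGE MODEL: `rank(θ ↦ θ ∧ E_p ∣ ⋀^k K^{2m}) = C(m,k)·min(k+1, m+1−k, p+1, m+1−p)`** for `k, p ≤ m`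
(`w_m(δ_p) = E_p = Σ_{|S| = p} Π (y if a ∈ S else x)`, th-7's closed form). `p = 0`: `C(m,k)` (the pure class); `p = 1`: `2C(m,k) − [k=0] − [k=m]`
(the bare `Θ`); the rank grows with `min(p, m−p)`. -/
theorem finrank_range_wedge_w_spikeSeq {k : ℕ} (hk : k ≤ m) {p : ℕ} (hp : p ≤ m) :
    finrank K (LinearMap.range (Hankel.wedge K m k (Hankel.w K m m (spikeSeq K p)))) =
      m.choose k * min (min (k + 1) (m + 1 - k)) (min (p + 1) (m + 1 - p)) := by
  rw [Hankel.hankelLaw_model, rank_hankel1_spikeSeq_eq_min K hk hp]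

/-- consistency with the bare `Θ` (`p = 1`, `0 < k < m`): `C(m,k)·min(k+1, m+1−k, 2, m) = 2·C(m,k)` = th-7's `pointPairRank m k`. -/
theorem finrank_range_wedge_w_spike_one {k : ℕ} (hk0 : 0 < k) (hkm : k < m) :
    finrank K (LinearMap.range (Hankel.wedge K m k (Hankel.w K m m (spikeSeq K 1)))) = WedgePair.pointPairRank m k := by
  rw [finrank_range_wedge_w_spikeSeq K m hkm.le (by omega), WedgePair.pointPairRank, if_neg (by omega), if_neg (by omega),
    Nat.sub_zero, Nat.sub_zero]
  have : min (min (k + 1) (m + 1 - k)) (min (1 + 1) (m + 1 - 1)) = 2 := by omega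
  rw [this, mul_comm]

/-! ## §3. The ceiling is sharp: the middle power `Θ^{⌊m/2⌋}` is Hankel-generic -/

variable {m}

/-- **`rank H_k(δ_{⌊m/2⌋}) = min(k+1, m+1−k)`** for every `k ≤ m`: the middle spike attains the ceiling of §1 in every degree. -/
theorem rank_hankel1_spike_middle {k : ℕ} (hk : k ≤ m) :
    (Hankel.hankel1 K m k (spikeSeq K (m / 2))).rank = min (k + 1) (m + 1 - k) := by
  rw [rank_hankel1_spikeSeq K hk (m / 2)]
  omega

variable (m)

/-- **THE CEILING IS ATTAINED: `rank(θ ↦ θ ∧ E_{⌊m/2⌋} ∣ ⋀^k K^{2m}) = C(m,k)·min(k+1, m+1−k)` for EVERY `k`** (both sides `0` for `k > m`) —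
one pure power, the middle one, realises C15's «generic» Hankel ranks in all degrees at once; with `finrank_range_wedge_w_le` the ceiling is sharp
for every `m` and `k`. -/
theorem finrank_range_wedge_w_spike_middle (k : ℕ) :
    finrank K (LinearMap.range (Hankel.wedge K m k (Hankel.w K m m (spikeSeq K (m / 2))))) = m.choose k * min (k + 1) (m + 1 - k) := by
  rw [Hankel.hankelLaw_model]
  rcases Nat.lt_or_ge m k with hk | hk
  · rw [Nat.choose_eq_zero_of_lt hk, zero_mul, zero_mul]
  · rw [rank_hankel1_spike_middle K hk]

/-- the middle power in degree `2`, `m ≥ 4`: rank exactly `3·C(m,2)` — th-6's generic number, attained. -/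
theorem finrank_range_wedge_w_spike_middle_two (hm : 4 ≤ m) :
    finrank K (LinearMap.range (Hankel.wedge K m 2 (Hankel.w K m m (spikeSeq K (m / 2))))) = 3 * m.choose 2 := by
  rw [finrank_range_wedge_w_spike_middle, ceiling_two m hm]

/-! ## §4. The same in th-6's typing (`FormulaN.wedgeWith`), transported along th-7's `Φ` -/

/-- **THE CEILING in th-6's typing**: `finrank (range (wedgeWith k q)) ≤ C(m,k)·min(k+1, m+1−k)` for every field, `m`, `k`, `q`. -/
theorem ceilingLawAt (k : ℕ) (q : ℕ → K) :
    finrank K (LinearMap.range (FormulaN.wedgeWith K m k q)) ≤ m.choose k * min (k + 1) (m + 1 - k) := by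
  rw [HankelFaces.finrank_range_wedgeWith_eq_w]
  exact finrank_range_wedge_w_le K m k q

/-- **THE PURE POWER LAW in th-6's typing**: for `v = Θ^p/p!` (`q = δ_p`), `k, p ≤ m`:
`finrank (range (wedgeWith k δ_p)) = C(m,k)·min(k+1, m+1−k, p+1, m+1−p)`. -/
theorem purePowerLawAt {k : ℕ} (hk : k ≤ m) {p : ℕ} (hp : p ≤ m) :
    finrank K (LinearMap.range (FormulaN.wedgeWith K m k fun j => if j = p then (1 : K) else 0)) =
      m.choose k * min (min (k + 1) (m + 1 - k)) (min (p + 1) (m + 1 - p)) := by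
  rw [HankelFaces.finrank_range_wedgeWith_eq_w]
  exact finrank_range_wedge_w_spikeSeq K m hk hp

/-- **THE MIDDLE POWER LAW in th-6's typing**: `finrank (range (wedgeWith k δ_{⌊m/2⌋})) = C(m,k)·min(k+1, m+1−k)` for every `k`. -/
theorem middlePowerLawAt (k : ℕ) :
    finrank K (LinearMap.range (FormulaN.wedgeWith K m k fun j => if j = m / 2 then (1 : K) else 0)) =
      m.choose k * min (k + 1) (m + 1 - k) := by
  rw [HankelFaces.finrank_range_wedgeWith_eq_w]
  exact finrank_range_wedge_w_spike_middle K m k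

end Summit.Ventures.HSemireg.Wedge.HankelSpikes
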